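import Literature.NumberTheory.Weil1964.ArchMetaplecticLeviCover
import HarnessLib

/-!
# The dual Levi pair `(a, d)` of a Siegel element: `det a · det d = 1`, `(m(a,d)n(b))(0,y) = (0, d y)`, `|det a|^{-1} = det d`

Topic `NumberTheory/Weil1964`; namespace `Literature.NumberTheory.Weil1964`.  KERNEL MATHEMATICS ONLY: proved theorems;
no definition, no `def … : Prop` record, no axiom, no proof hole.

For a Siegel element `m(a, d) n(b)` of `Sp(ℝ^σ × ℝ^σ)` ([Folland1989, (4.24)–(4.25)]; [Weil1964, Chap. I n° 6 p. 151]) the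
Levi blocks are dual for the dot pairing, `a x · d y = x · y`, so `ᵗA D = 1` (`Sp.transpose_toMatrix_mul_toMatrix_eq_one`
of `ArchMetaplecticLeviCover`) and **`det a · det d = 1`** (`det_mul_det_eq_one_of_dual`); the element acts on the Lagrangian `𝕐 = 0 × ℝ^σ` through `d`
(`leviSp_mul_unipotentSp_apply_zero`); and Folland's normalising factor satisfies **`(|det a|^{-1/2})² = det d`** when
`det d > 0` (`leviFactor_sq_eq_det`).  These reduce the modulus `|det a|^{-1/2}` of the Schwartz-model Levi operator to a
determinant computed on `𝕐` — the form in which the Siegel-parabolic normalisation `|det_Δ p|^{1/2}` of the doubled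
unitary Weil representation is read ([Kudla1994, §3]; [HarrisKudlaSweet1996, §1]).

## References

* [Folland1989] G. B. Folland, *Harmonic Analysis in Phase Space*, Princeton UP 1989, §4.2 (4.24)–(4.25).
* [Weil1964] A. Weil, Acta Math. 111 (1964), Chap. I n° 6 p. 151.
* [Kudla1994] S. Kudla, Israel J. Math. 87 (1994), §3.
-/

set_option autoImplicit false

noncomputable section

open scoped Matrix

namespace Literature.NumberTheory.Weil1964

open Literature.Analysis.SegalBargmann Literature.RepresentationTheory.HeisenbergGroup

variable {σ : Type*} [Fintype σ] [DecidableEq σ]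

/-- **`det a · det d = 1`** for dual Levi blocks. [cite: Folland1989, §4.2 (4.24)] -/
theorem det_mul_det_eq_one_of_dual (a d : (σ → ℝ) ≃ₗ[ℝ] (σ → ℝ))
    (had : ∀ x y, dotPairing σ (a x) (d y) = dotPairing σ x y) :
    LinearMap.det (a : (σ → ℝ) →ₗ[ℝ] (σ → ℝ)) * LinearMap.det (d : (σ → ℝ) →ₗ[ℝ] (σ → ℝ)) = 1 := by
  have h := congrArg Matrix.det (Sp.transpose_toMatrix_mul_toMatrix_eq_one a d had)
  rw [Matrix.det_mul, Matrix.det_transpose, Matrix.det_one, LinearMap.det_toMatrix', LinearMap.det_toMatrix'] at h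
  exact h

/-- `det a > 0 ↔ det d > 0` for dual Levi blocks. [cite: Folland1989, §4.2 (4.24)] -/
theorem det_pos_iff_of_dual (a d : (σ → ℝ) ≃ₗ[ℝ] (σ → ℝ)) (had : ∀ x y, dotPairing σ (a x) (d y) = dotPairing σ x y) :
    0 < LinearMap.det (a : (σ → ℝ) →ₗ[ℝ] (σ → ℝ)) ↔ 0 < LinearMap.det (d : (σ → ℝ) →ₗ[ℝ] (σ → ℝ)) := by
  have h := det_mul_det_eq_one_of_dual a d had
  constructor
  · intro ha
    by_contra hd
    rw [not_lt] at hd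
    have : LinearMap.det (a : (σ → ℝ) →ₗ[ℝ] (σ → ℝ)) * LinearMap.det (d : (σ → ℝ) →ₗ[ℝ] (σ → ℝ)) ≤ 0 :=
      mul_nonpos_of_nonneg_of_nonpos ha.le hd
    linarith
  · intro hd
    by_contra ha
    rw [not_lt] at ha
    have : LinearMap.det (a : (σ → ℝ) →ₗ[ℝ] (σ → ℝ)) * LinearMap.det (d : (σ → ℝ) →ₗ[ℝ] (σ → ℝ)) ≤ 0 :=
      mul_nonpos_of_nonpos_of_nonneg ha hd.le
    linarith

omit [DecidableEq σ] in
/-- **`(m(a,d) n(b)) (0, y) = (0, d y)`**: a Siegel element acts on `𝕐` through `d`. [cite: Weil1964, Chap. I n° 6 p. 151] -/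
theorem leviSp_mul_unipotentSp_apply_zero (a d : (σ → ℝ) ≃ₗ[ℝ] (σ → ℝ))
    (had : ∀ x y, dotPairing σ (a x) (d y) = dotPairing σ x y) (b : (σ → ℝ) →ₗ[ℝ] (σ → ℝ))
    (hb : ∀ x x', dotPairing σ x (b x') = dotPairing σ x' (b x)) (y : σ → ℝ) :
    (((leviSp (dotPairing σ) a d had * unipotentSp (dotPairing σ) b hb : symplecticGroup (polar (dotPairing σ))) :
        ((σ → ℝ) × (σ → ℝ)) ≃ₗ[ℝ] ((σ → ℝ) × (σ → ℝ))) (0, y)) = (0, d y) := by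
  show ((leviSp (dotPairing σ) a d had : symplecticGroup (polar (dotPairing σ))) : ((σ → ℝ) × (σ → ℝ)) ≃ₗ[ℝ] ((σ → ℝ) × (σ → ℝ)))
    (((unipotentSp (dotPairing σ) b hb : symplecticGroup (polar (dotPairing σ))) :
      ((σ → ℝ) × (σ → ℝ)) ≃ₗ[ℝ] ((σ → ℝ) × (σ → ℝ))) (0, y)) = _
  rw [coe_unipotentSp, unipotentσ_apply, coe_leviSp_apply]
  simp only [map_zero, add_zero]

/-- **`(|det a|^{-1/2})² = det d`** for dual Levi blocks with `det d > 0`. [cite: Folland1989, §4.2 (4.24)] -/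
theorem leviFactor_sq_eq_det (a d : (σ → ℝ) ≃ₗ[ℝ] (σ → ℝ)) (had : ∀ x y, dotPairing σ (a x) (d y) = dotPairing σ x y)
    (hd : 0 < LinearMap.det (d : (σ → ℝ) →ₗ[ℝ] (σ → ℝ))) :
    leviFactor a ^ 2 = ((LinearMap.det (d : (σ → ℝ) →ₗ[ℝ] (σ → ℝ)) : ℝ) : ℂ) := by
  have h := det_mul_det_eq_one_of_dual a d had
  have ha : 0 < LinearMap.det (a : (σ → ℝ) →ₗ[ℝ] (σ → ℝ)) := (det_pos_iff_of_dual a d had).2 hd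
  have hda : LinearMap.det (d : (σ → ℝ) →ₗ[ℝ] (σ → ℝ)) = (LinearMap.det (a : (σ → ℝ) →ₗ[ℝ] (σ → ℝ)))⁻¹ :=
    eq_inv_of_mul_eq_one_right h
  rw [leviFactor, ← Complex.ofReal_pow]
  congr 1
  rw [abs_of_pos ha, ← Real.rpow_natCast, ← Real.rpow_mul ha.le, hda, ← Real.rpow_neg_one]
  norm_num

end Literature.NumberTheory.Weil1964

end
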